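import Literature.NumberTheory.GaloisRepresentations.ContinuousCorestriction
import Literature.NumberTheory.GaloisRepresentations.ContinuousRep
import Mathlib.Topology.Algebra.Group.ClosedSubgroup
import Mathlib.Topology.Algebra.OpenSubgroup
import HarnessLib

/-!
# Continuous `H¹` with discrete coefficients: a class vanishing on a closed subgroup vanishes on an open one

`Proofs` file (theorems only; no definition with mathematical content beyond two auxiliary subgroups, no
named fact, no `sorry`). Generic glue for the restriction maps `resSubgroup X H 1 : H¹(G, X) → H¹(H, X)`
(`ContinuousCorestriction.lean`, Mathlib continuous cohomology) of a topological representation with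
DISCRETE coefficients:

* §1 `exists_isOpen_le_resSubgroup_eq_zero`: if `res_H c = 0` for a subgroup `H ≤ G` then `res_U c = 0` for
  an OPEN subgroup `U ≥ H` — writing `c = [φ]` with `φ|_H = ∂v`, the corrected crossed homomorphism
  `φ - ∂v` is continuous into a discrete module, so its kernel `{g | φ g = g•v - v}` is an open subgroup
  containing `H`, and `φ` is principal on it (Serre, *Galois Cohomology* I §2.2: `H¹` of a profinite group
  with discrete coefficients is the direct limit over open normal subgroups — this is the cocycle-level
  mechanism behind it).
* §2 `Subgroup.exists_le_of_iInf_le_of_isOpen`: in a COMPACT group, an open subgroup containing the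
  intersection of a decreasing sequence of closed subgroups contains one of them;
  `Subgroup.isOpen_normalCore_of_isOpen`: the normal core of an open subgroup of a compact group is open
  (public form of a lemma two `Frobenioids` files keep private).
* §3 `resSubgroup_eq_zero_imp_of_forall_isOpen_normal`: consequently, if `res_U` is injective on `H¹(G, X)`
  for every OPEN NORMAL subgroup `U` containing some member `Γ₀ ⊓ V n` of such a sequence, then every class
  vanishing on `Γ₀ ⊓ ⨅ n, V n` is zero — the shape of the `H¹(F(μ_{p^∞})/K, T̄) = 0` clause of Howard's
  hypothesis H.2 as typed in `Howard2004/SelmerTriples.lean` (`Howard2004.H2`: restriction to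
  `Γ_F ⊓ ⨅ n ker(Γ_K → Aut μ_{p^n})`), reduced to injectivity statements on OPEN subgroups such as the
  tree's `subgroupResKer … = ⊥` theorems (cell `pub/bsd-print-x9`, rows 9/10, v9 STUB 1a field `h2`).

References: J.-P. Serre, *Galois Cohomology* (1997), I.§2.2 (Prop. 8: `Hq(G, A) = lim→ Hq(G/U, A^U)`),
I.§5.1; B. Howard, Compositio Math. 140 (2004), §1.3 H.2 (arXiv:1202.6340 p. 7, L61–63).
-/

noncomputable section

open CategoryTheory Topology

universe u v

namespace Literature.NumberTheory.GaloisRepresentations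

variable {R : Type u} [Ring R] [TopologicalSpace R]
variable {G : Type v} [Group G] [TopologicalSpace G] [IsTopologicalGroup G]

/-! ## §1 From a closed subgroup to an open one -/

section OpenKernel

variable (X : TopRep.{v} R G)

omit [IsTopologicalGroup G] in
/-- **The agreement subgroup of a crossed homomorphism and a principal one**: for a continuous crossed
homomorphism `φ : G → X` and `v ∈ X`, the set `{g | φ g = g•v - v}` is a subgroup (it is the kernel of the
crossed homomorphism `φ - ∂v`). [cite: SerreGaloisCohomology1997, Ch. I §5.1 (crossed homomorphisms, principal ones)] -/
def principalAgreement (φ : contOneCocycles X) (v : X) : Subgroup G where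
  carrier := {g | φ.1 g = X.ρ g v - v}
  mul_mem' := by
    intro a b ha hb
    simp only [Set.mem_setOf_eq] at ha hb ⊢
    rw [(mem_contOneCocycles_iff φ.1).mp φ.2 a b, ha, hb, map_sub, ρ_mul_apply]
    abel
  one_mem' := by
    simp only [Set.mem_setOf_eq, contOneCocycles.apply_one, map_one]
    exact (sub_self _).symm
  inv_mem' := by
    intro a ha
    simp only [Set.mem_setOf_eq] at ha ⊢
    have h := (mem_contOneCocycles_iff φ.1).mp φ.2 a⁻¹ a
    rw [inv_mul_cancel, contOneCocycles.apply_one, ha, map_sub, ρ_inv_apply_ρ_apply] at h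
    -- `0 = φ a⁻¹ + (v - a⁻¹ • v)`
    have : φ.1 a⁻¹ = -(v - X.ρ a⁻¹ v) := eq_neg_of_add_eq_zero_left h.symm
    rw [this, neg_sub]

omit [IsTopologicalGroup G] in
/-- Membership in `principalAgreement`. [cite: SerreGaloisCohomology1997, Ch. I §5.1] -/
@[simp]
theorem mem_principalAgreement_iff (φ : contOneCocycles X) (v : X) (g : G) :
    g ∈ principalAgreement X φ v ↔ φ.1 g = X.ρ g v - v :=
  Iff.rfl

omit [IsTopologicalGroup G] in
/-- With DISCRETE coefficients and a continuous orbit map `g ↦ g•v`, the agreement subgroup is OPEN (the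
kernel of a continuous crossed homomorphism into a discrete module).
[cite: SerreGaloisCohomology1997, Ch. I §2.2 (discrete modules: stabilisers and kernels are open)] -/
theorem isOpen_principalAgreement [DiscreteTopology X] (φ : contOneCocycles X) (v : X)
    (hv : Continuous fun g : G => X.ρ g v) :
    IsOpen (principalAgreement X φ v : Set G) := by
  have hc : Continuous fun g : G => φ.1 g - (X.ρ g v - v) :=
    φ.1.continuous.sub (hv.sub continuous_const)
  have : (principalAgreement X φ v : Set G) = (fun g : G => φ.1 g - (X.ρ g v - v)) ⁻¹' {0} := by
    ext g
    simp only [SetLike.mem_coe, mem_principalAgreement_iff, Set.mem_preimage, Set.mem_singleton_iff,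
      sub_eq_zero]
  rw [this]
  exact (isOpen_discrete _).preimage hc

/-- A class is zero on a subgroup iff a representing cocycle is principal there: `res_H [φ] = 0 ↔
∃ v, ∀ h ∈ H, φ h = h•v - v`. [cite: SerreGaloisCohomology1997, Ch. I §5.1] -/
theorem resSubgroup_oneCocycleClass_eq_zero_iff (H : Subgroup G) (φ : contOneCocycles X) :
    resSubgroup X H 1 (oneCocycleClass X φ) = 0 ↔ ∃ v : X, ∀ h : G, h ∈ H → φ.1 h = X.ρ h v - v := by
  rw [resSubgroup_oneCocycleClass, oneCocycleClass_eq_zero_iff]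
  constructor
  · rintro ⟨v, hv⟩
    exact ⟨v, fun h hh => hv ⟨h, hh⟩⟩
  · rintro ⟨v, hv⟩
    exact ⟨v, fun h => hv h h.2⟩

/-- **A class of `H¹(G, X)` (discrete `X`, continuous orbit maps) vanishing on a subgroup `H` vanishes on an
OPEN subgroup containing `H`** — namely on the agreement subgroup of a representing cocycle with the
principal cocycle it equals on `H`. [cite: SerreGaloisCohomology1997, Ch. I §2.2 Prop. 8 (H¹ of a profinite group with discrete coefficients is the limit over open subgroups)] -/
theorem exists_isOpen_le_resSubgroup_eq_zero [DiscreteTopology X] (hX : ∀ v : X, Continuous fun g : G => X.ρ g v)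
    (H : Subgroup G) (c : continuousCohomology 1 X) (hc : resSubgroup X H 1 c = 0) :
    ∃ U : Subgroup G, IsOpen (U : Set G) ∧ H ≤ U ∧ resSubgroup X U 1 c = 0 := by
  obtain ⟨φ, rfl⟩ := oneCocycleClass_surjective X c
  obtain ⟨v, hv⟩ := (resSubgroup_oneCocycleClass_eq_zero_iff X H φ).mp hc
  refine ⟨principalAgreement X φ v, isOpen_principalAgreement X φ v (hX v), fun h hh => hv h hh, ?_⟩
  exact (resSubgroup_oneCocycleClass_eq_zero_iff X _ φ).mpr ⟨v, fun g hg => hg⟩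

end OpenKernel

/-! ## §2 Compact groups: open subgroups versus intersections of closed ones; the normal core -/

section Compact

omit [IsTopologicalGroup G] in
/-- **In a compact group, an open subgroup containing `⨅ n, V n` for a DECREASING sequence of CLOSED
subgroups contains some `V n`** (the closed sets `V n \\ U` are compact, decreasing, with empty
intersection). [cite: SerreGaloisCohomology1997, Ch. I §1.1 (profinite groups: open subgroups and intersections of closed subgroups)] -/
theorem Subgroup.exists_le_of_iInf_le_of_isOpen [CompactSpace G] (V : ℕ → Subgroup G)
    (hV : Antitone V) (hclosed : ∀ n, IsClosed (V n : Set G)) (U : Subgroup G) (hU : IsOpen (U : Set G))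
    (h : ⨅ n, V n ≤ U) : ∃ n, V n ≤ U := by
  -- the compact sets `V n ∩ Uᶜ` are directed (decreasing) with empty intersection
  have hempty : ⋂ n, ((V n : Set G) ∩ (U : Set G)ᶜ) = ∅ := by
    ext g
    simp only [Set.mem_iInter, Set.mem_inter_iff, Set.mem_compl_iff, SetLike.mem_coe,
      Set.mem_empty_iff_false, iff_false, not_forall]
    by_contra hg
    push Not at hg
    have hgV : g ∈ ⨅ n, V n := Subgroup.mem_iInf.mpr fun n => (hg n).1
    exact (hg 0).2 (h hgV)
  have hdir : Directed (· ⊇ ·) fun n => (V n : Set G) ∩ (U : Set G)ᶜ := fun m n =>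
    ⟨max m n, Set.inter_subset_inter_left _ (hV (le_max_left m n)),
      Set.inter_subset_inter_left _ (hV (le_max_right m n))⟩
  obtain ⟨n, hn⟩ := IsCompact.elim_directed_family_closed (isCompact_univ (X := G))
    (fun n => (V n : Set G) ∩ (U : Set G)ᶜ) (fun n => (hclosed n).inter (isClosed_compl_iff.mpr hU))
    (by rw [Set.univ_inter]; exact hempty) hdir
  refine ⟨n, fun g hg => ?_⟩
  by_contra hgU
  have : g ∈ Set.univ ∩ ((V n : Set G) ∩ (U : Set G)ᶜ) := ⟨Set.mem_univ _, hg, hgU⟩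
  rw [hn] at this
  exact this

/-- **The normal core of an open subgroup of a compact group is open** (it is closed of finite index:
Mathlib `Subgroup.normalCore_isClosed`, `Subgroup.isOpen_of_isClosed_of_finiteIndex`).
[cite: SerreGaloisCohomology1997, Ch. I §1.1 (open subgroups of profinite groups: finite index, open normal core)] -/
theorem Subgroup.isOpen_normalCore_of_isOpen [CompactSpace G] (U : Subgroup G) (hU : IsOpen (U : Set G)) :
    IsOpen (U.normalCore : Set G) := by
  haveI : Finite (G ⧸ U) := Subgroup.quotient_finite_of_isOpen U hU
  haveI : U.FiniteIndex := Subgroup.finiteIndex_of_finite_quotient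
  haveI : U.normalCore.FiniteIndex := Subgroup.finiteIndex_normalCore U
  exact Subgroup.isOpen_of_isClosed_of_finiteIndex _ (U.normalCore_isClosed (Subgroup.isClosed_of_isOpen U hU))

end Compact

/-! ## §3 The H.2-shaped clause from injectivity on open normal subgroups -/

section H2Shape

variable (X : TopRep.{v} R G)

/-- Restriction to a smaller subgroup factors through restriction to a larger one, on classes:
`res_H c = 0 → res_{H'} c = 0` for `H' ≤ H`. [cite: SerreGaloisCohomology1997, Ch. I §2.4 (transitivity of restriction)] -/
theorem resSubgroup_eq_zero_of_le {H H' : Subgroup G} (hle : H' ≤ H) (c : continuousCohomology 1 X)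
    (hc : resSubgroup X H 1 c = 0) : resSubgroup X H' 1 c = 0 := by
  obtain ⟨φ, rfl⟩ := oneCocycleClass_surjective X c
  obtain ⟨v, hv⟩ := (resSubgroup_oneCocycleClass_eq_zero_iff X H φ).mp hc
  exact (resSubgroup_oneCocycleClass_eq_zero_iff X H' φ).mpr ⟨v, fun h hh => hv h (hle hh)⟩

/-- **The typed H.2 clause from open injectivity.** Let `G` be compact, `X` discrete with continuous orbit
maps, `Γ₀ ≤ G` closed and `V : ℕ → Subgroup G` a decreasing sequence of closed subgroups. If for every
`n` and every OPEN NORMAL subgroup `U` with `Γ₀ ⊓ V n ≤ U` the restriction `H¹(G, X) → H¹(U, X)` is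
injective, then every class vanishing on `Γ₀ ⊓ ⨅ n, V n` is zero — the shape of
`H¹(F(μ_{p^∞})/K, T̄) = 0` in `Howard2004.H2` (`Γ₀ = Γ_F`, `V n = ker(Γ_K → Aut μ_{p^n})`).
[cite: Howard2004HeegnerKolyvagin, H.2 (arXiv:1202.6340 p. 7, L61–63)]
[cite: SerreGaloisCohomology1997, Ch. I §2.2 Prop. 8] -/
theorem resSubgroup_eq_zero_imp_of_forall_isOpen_normal [CompactSpace G] [DiscreteTopology X]
    (hX : ∀ v : X, Continuous fun g : G => X.ρ g v) (Γ₀ : Subgroup G) [Γ₀.Normal]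
    (hΓ₀ : IsClosed (Γ₀ : Set G)) (V : ℕ → Subgroup G) [∀ n, (V n).Normal] (hV : Antitone V)
    (hclosed : ∀ n, IsClosed (V n : Set G))
    (hinj : ∀ (n : ℕ) (U : Subgroup G), U.Normal → IsOpen (U : Set G) → Γ₀ ⊓ V n ≤ U →
      ∀ c : continuousCohomology 1 X, resSubgroup X U 1 c = 0 → c = 0)
    (c : continuousCohomology 1 X) (hc : resSubgroup X (Γ₀ ⊓ ⨅ n, V n) 1 c = 0) : c = 0 := by
  -- an open subgroup `U₀ ⊇ Γ₀ ⊓ ⨅ V n` on which `c` vanishes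
  obtain ⟨U₀, hU₀open, hle, hU₀⟩ := exists_isOpen_le_resSubgroup_eq_zero X hX _ c hc
  -- `Γ₀ ⊓ V n ≤ U₀` for some `n` (compactness, applied to the decreasing closed family `Γ₀ ⊓ V n`)
  have hiInf : (⨅ n, Γ₀ ⊓ V n) = Γ₀ ⊓ ⨅ n, V n := by
    apply le_antisymm
    · refine le_inf ((iInf_le _ 0).trans inf_le_left) (le_iInf fun n => (iInf_le _ n).trans inf_le_right)
    · exact le_iInf fun n => inf_le_inf_left _ (iInf_le _ n)
  have hVc : ∀ n, IsClosed (((Γ₀ ⊓ V n : Subgroup G)) : Set G) := fun n => by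
    rw [Subgroup.coe_inf]; exact hΓ₀.inter (hclosed n)
  obtain ⟨n, hn⟩ := Subgroup.exists_le_of_iInf_le_of_isOpen (fun n => (Γ₀ ⊓ V n : Subgroup G))
    (fun m n hmn => inf_le_inf_left _ (hV hmn)) hVc U₀ hU₀open (by rw [hiInf]; exact hle)
  -- pass to the open normal core and restrict further
  have hcore : IsOpen (U₀.normalCore : Set G) := Subgroup.isOpen_normalCore_of_isOpen U₀ hU₀open
  haveI : (Γ₀ ⊓ V n).Normal := Subgroup.normal_inf_normal Γ₀ (V n)
  have hle' : Γ₀ ⊓ V n ≤ U₀.normalCore := Subgroup.normal_le_normalCore.mpr hn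
  exact hinj n U₀.normalCore inferInstance hcore hle' c
    (resSubgroup_eq_zero_of_le X (Subgroup.normalCore_le U₀) c hU₀)

end H2Shape

/-! ## §4 The case of a `ContinuousRep` on a discrete module (orbit maps are continuous) -/

section ContinuousRepCase

variable {A : Type u} [CommRing A] [TopologicalSpace A]
  {M : Type v} [AddCommGroup M] [Module A M] [TopologicalSpace M] [DiscreteTopology M]

/-- For the topological representation of a `ContinuousRep` on a discrete module (e.g. a
`DiscreteGaloisModule`), the orbit maps `g ↦ g•v` are continuous, so §1–§3 apply: a class vanishing on a
subgroup vanishes on an open subgroup containing it. [cite: SerreGaloisCohomology1997, Ch. I §2.2 Prop. 8] -/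
theorem ContinuousRep.exists_isOpen_le_resSubgroup_eq_zero [ContinuousSMul A M] (ρ : ContinuousRep G A M)
    (H : Subgroup G) (c : continuousCohomology 1 ρ.toTopRep) (hc : resSubgroup ρ.toTopRep H 1 c = 0) :
    ∃ U : Subgroup G, IsOpen (U : Set G) ∧ H ≤ U ∧ resSubgroup ρ.toTopRep U 1 c = 0 :=
  Literature.NumberTheory.GaloisRepresentations.exists_isOpen_le_resSubgroup_eq_zero ρ.toTopRep
    (fun v => ρ.continuous_apply_left v) H c hc

/-- The H.2-shaped clause for a `ContinuousRep` on a discrete module over a compact group, from injectivity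
of restriction to open normal subgroups. [cite: Howard2004HeegnerKolyvagin, H.2 (arXiv:1202.6340 p. 7, L61–63)]
[cite: SerreGaloisCohomology1997, Ch. I §2.2 Prop. 8] -/
theorem ContinuousRep.resSubgroup_eq_zero_imp_of_forall_isOpen_normal [CompactSpace G] [ContinuousSMul A M]
    (ρ : ContinuousRep G A M) (Γ₀ : Subgroup G) [Γ₀.Normal] (hΓ₀ : IsClosed (Γ₀ : Set G))
    (V : ℕ → Subgroup G) [∀ n, (V n).Normal] (hV : Antitone V) (hclosed : ∀ n, IsClosed (V n : Set G))
    (hinj : ∀ (n : ℕ) (U : Subgroup G), U.Normal → IsOpen (U : Set G) → Γ₀ ⊓ V n ≤ U →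
      ∀ c : continuousCohomology 1 ρ.toTopRep, resSubgroup ρ.toTopRep U 1 c = 0 → c = 0)
    (c : continuousCohomology 1 ρ.toTopRep) (hc : resSubgroup ρ.toTopRep (Γ₀ ⊓ ⨅ n, V n) 1 c = 0) :
    c = 0 :=
  Literature.NumberTheory.GaloisRepresentations.resSubgroup_eq_zero_imp_of_forall_isOpen_normal ρ.toTopRep
    (fun v => ρ.continuous_apply_left v) Γ₀ hΓ₀ V hV hclosed hinj c hc

end ContinuousRepCase

end Literature.NumberTheory.GaloisRepresentations

end
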